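import Summits.Schanuel.Schanuel.Theorems.DiophantineDichotomyApproximationPropertyExistsPrimeFactorMem
import Literature.NumberTheory.Transcendental.NesterenkoEliminationProp47HeightsProofs
import Literature.NumberTheory.Transcendental.NesterenkoIntegerHeights
import Literature.NumberTheory.Transcendental.NesterenkoEliminationFacts2Proofs
import Literature.NumberTheory.Transcendental.NesterenkoEliminationCor410Proofs
import Literature.NumberTheory.Transcendental.NesterenkoCoeffNorms
import HarnessLib

/-!
# Stub `primePartSplit3` of line `orbit-interpolation-determinant` (crux `ApproximationProperty`, stmt-Schanuel-6117)

Route `DiophantineDichotomy` (sub-problem `Schanuel/Schanuel`), crux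
`Summit.Schanuel.Schanuel.Theses.DiophantineDichotomy.ApproximationProperty` (stmt-Schanuel-6117),
line `orbit-interpolation-determinant`, skeleton v27, registered support stub `primePartSplit3`:
**a non-zero form `F` of degree `d` of `ℚ[x₀, …, x₃]` lying in a prime ideal `𝔮'` splits as
`F = G₂ · ∏ᵢ pᵢ`** with `G₂ ∉ 𝔮'` a non-zero form of degree `d₂`, `k ≥ 1` prime forms `pᵢ ∈ 𝔮'`
of degrees `aᵢ ≥ 1` (each `(pᵢ)` a prime ideal), `d = d₂ + ∑ aᵢ`, and the Gelfond-type
bookkeeping `h(G₂), h(pᵢ) ≤ h(F) + 4d`, `|F| ≤ e^{4d} |G₂| ∏ |pᵢ|`.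

Proof.
* The split (`PrimePartSplit.exists_split`): strong induction on `d`. A non-zero `F ∈ 𝔮'` has a
  prime factor `p ∈ 𝔮'` (`ExistsPrimeFactorMem.exists_prime_dvd_mem`), `F = p F₁`; both factors
  are forms (`Roy2013.isHomogeneous_of_dvd`), `deg p ≥ 1`
  (`ExistsPrimeFactorMem.one_le_totalDegree_of_prime`), so `deg F₁ < d`; stop if `F₁ ∉ 𝔮'`,
  otherwise recurse on `F₁` and prepend `p`.
* Heights (`PrimePartSplit.height_le_height_prod_add`): write every factor as a non-zero rational
  times a primitive integer polynomial (`exists_eq_C_mul_map_primitive`); heights ignore the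
  constants (`height_C_mul`), and Gauss + Gelfond (`sum_mul_height_map_le`) bound the sum of the
  heights of the factors by the height of the product plus `∑_v ∑_i deg_v`, at most `4d` for
  forms in `4` variables whose degrees add up to `d`; every height is `≥ 0`.
* Max-norms (`PrimePartSplit.maxNorm_mul_prod_le`): iterate `|PQ| ≤ #supp(P) |P| |Q|`
  (`maxNorm_mul_le`); a form of degree `a` in `4` variables has `≤ 4^a` monomials
  (`card_support_le_pow_of_isHomogeneous`), and `4^{∑ aᵢ} ≤ 4^d ≤ e^{4d}`.

Proofs only: no definitions, nothing asserted beyond the registered stub and folklore helpers.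
Sources: folklore (Gauss: `ℚ[x₀, …, x₃]` is factorial; Gelfond's inequality as recorded in the tree).
-/

set_option linter.dupNamespace false

noncomputable section

namespace Summit.Schanuel.Schanuel.Cruxes.ApproximationProperty.OrbitInterpolationDeterminant

open Literature.NumberTheory.Transcendental Literature.NumberTheory.Transcendental.Nesterenko
open MvPolynomial
open scoped BigOperators

namespace PrimePartSplit

/-- **The pure split.** A non-zero form `F` of degree `d` of `ℚ[x₀, …, x₃]` lying in a prime ideal
`𝔮'` is `G₂ · ∏ᵢ pᵢ` with `G₂ ∉ 𝔮'` a non-zero form, `k ≥ 1` prime forms `pᵢ ∈ 𝔮'` of positive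
degrees `aᵢ`, and `d = deg G₂ + ∑ aᵢ` (induction on `d`, peeling off one prime factor in `𝔮'` at a
time). [folklore] -/
theorem exists_split {𝔮' : Ideal (Rx 3)} (h𝔮' : 𝔮'.IsPrime) (d : ℕ) :
    ∀ F : Rx 3, F ≠ 0 → F.IsHomogeneous d → F ∈ 𝔮' →
      ∃ (G₂ : Rx 3) (d₂ k : ℕ) (p : Fin k → Rx 3) (a : Fin k → ℕ), G₂ ≠ 0 ∧ G₂ ∉ 𝔮' ∧
        G₂.IsHomogeneous d₂ ∧ (∀ i, p i ≠ 0 ∧ p i ∈ 𝔮' ∧ (p i).IsHomogeneous (a i) ∧ 1 ≤ a i ∧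
          (Ideal.span {p i}).IsPrime) ∧ 1 ≤ k ∧ F = G₂ * ∏ i, p i ∧ d = d₂ + ∑ i, a i := by
  induction d using Nat.strong_induction_on with
  | _ d ih =>
  intro F hF0 hF hF𝔮
  obtain ⟨p, hp, hpF, hp𝔮⟩ := ExistsPrimeFactorMem.exists_prime_dvd_mem hF0 h𝔮' hF𝔮
  obtain ⟨F₁, rfl⟩ := hpF
  have hp0 : p ≠ 0 := hp.ne_zero
  have hF₁0 : F₁ ≠ 0 := right_ne_zero_of_mul hF0
  have hph : p.IsHomogeneous p.totalDegree :=
    Roy2013.isHomogeneous_of_dvd hF hF0 (dvd_mul_right p F₁)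
  have hF₁h : F₁.IsHomogeneous F₁.totalDegree :=
    Roy2013.isHomogeneous_of_dvd hF hF0 (dvd_mul_left F₁ p)
  have ha1 : 1 ≤ p.totalDegree := ExistsPrimeFactorMem.one_le_totalDegree_of_prime hp
  have hd : d = p.totalDegree + F₁.totalDegree := hF.inj_right (hph.mul hF₁h) hF0
  have hspan : (Ideal.span {p}).IsPrime := (Ideal.span_singleton_prime hp0).mpr hp
  by_cases hF₁𝔮 : F₁ ∈ 𝔮'
  · -- recurse on the cofactor `F₁ ∈ 𝔮'`, of smaller degree, and prepend `p`
    have hlt : F₁.totalDegree < d := by omega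
    obtain ⟨G₂, d₂, k, q, b, hG0, hG𝔮, hGh, hq, -, hF₁eq, hd₁⟩ := ih _ hlt F₁ hF₁0 hF₁h hF₁𝔮
    refine ⟨G₂, d₂, k + 1, Fin.cons p q, Fin.cons p.totalDegree b, hG0, hG𝔮, hGh, ?_,
      le_add_self, ?_, ?_⟩
    · intro i
      refine Fin.cases ?_ (fun j => ?_) i
      · simp only [Fin.cons_zero]
        exact ⟨hp0, hp𝔮, hph, ha1, hspan⟩
      · simp only [Fin.cons_succ]
        exact hq j
    · rw [Fin.prod_univ_succ]
      simp only [Fin.cons_zero, Fin.cons_succ]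
      rw [hF₁eq]
      ring
    · rw [Fin.sum_univ_succ]
      simp only [Fin.cons_zero, Fin.cons_succ]
      omega
  · -- stop: `G₂ = F₁ ∉ 𝔮'`, one prime factor `p`
    refine ⟨F₁, F₁.totalDegree, 1, fun _ => p, fun _ => p.totalDegree, hF₁0, hF₁𝔮, hF₁h,
      fun _ => ⟨hp0, hp𝔮, hph, ha1, hspan⟩, le_rfl, ?_, ?_⟩
    · simp [mul_comm]
    · simp only [Finset.univ_unique, Finset.sum_singleton]
      omega

/-- **Gauss + Gelfond for a finite product over `ℚ`.** For non-zero `P_i ∈ ℚ[x_1, …, x_n]`,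
`h(P_j) ≤ h(∏ᵢ Pᵢ) + ∑_v ∑ᵢ deg_v Pᵢ` for every `j`: write `Pᵢ = cᵢ Zᵢ` with `Zᵢ` primitive
integer, so that `h(Pᵢ) = h(Zᵢ)`, `h(∏ Pᵢ) = h(∏ Zᵢ)`, apply `sum_mul_height_map_le` and drop the
other (non-negative) heights. [folklore] -/
theorem height_le_height_prod_add {ι : Type*} [Fintype ι] {n : ℕ} (P : ι → MvPolynomial (Fin n) ℚ)
    (hP : ∀ i, P i ≠ 0) (j : ι) :
    height (P j) ≤ height (∏ i, P i) + ((∑ v : Fin n, ∑ i, degreeOf v (P i) : ℕ) : ℝ) := by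
  classical
  choose c hc Z hPZ hsupp hgcd using fun i => exists_eq_C_mul_map_primitive (P i) (hP i)
  have hprod : ∏ i, P i = C (∏ i, c i) * map (Int.castRingHom ℚ) (∏ i, Z i) := by
    rw [map_prod C, map_prod (map (Int.castRingHom ℚ)), ← Finset.prod_mul_distrib]
    exact Finset.prod_congr rfl fun i _ => hPZ i
  have hc0 : ∏ i, c i ≠ 0 := Finset.prod_ne_zero_iff.mpr fun i _ => hc i
  have hhprod : height (∏ i, P i) = height (map (Int.castRingHom ℚ) (∏ i, Z i)) := by
    rw [hprod, height_C_mul hc0]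
  have hhP : ∀ i, height (P i) = height (map (Int.castRingHom ℚ) (Z i)) := fun i => by
    rw [hPZ i, height_C_mul (hc i)]
  have hmain := sum_mul_height_map_le (σ := Fin n) Finset.univ (fun _ => 1) Z (fun i _ => hgcd i)
  simp only [Nat.cast_one, one_mul, pow_one] at hmain
  have hdeg : ∀ v i, degreeOf v (Z i) = degreeOf v (P i) := fun v i =>
    degreeOf_eq_of_support_eq (hsupp i) v
  simp_rw [hdeg] at hmain
  have hsingle : height (map (Int.castRingHom ℚ) (Z j)) ≤
      ∑ i, height (map (Int.castRingHom ℚ) (Z i)) :=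
    Finset.single_le_sum (f := fun i => height (map (Int.castRingHom ℚ) (Z i)))
      (fun i _ => height_nonneg _) (Finset.mem_univ j)
  rw [hhP j, hhprod]
  push_cast at hmain ⊢
  linarith

/-- **`|Q ∏ᵢ fᵢ| ≤ (∏ᵢ #supp fᵢ) |Q| ∏ᵢ |fᵢ|`**, iterating `|PQ| ≤ #supp(P) |P| |Q|`. [folklore] -/
theorem maxNorm_mul_prod_le {σ K ι : Type*} [NormedField K] (s : Finset ι) (Q : MvPolynomial σ K)
    (f : ι → MvPolynomial σ K) :
    maxNorm (Q * ∏ i ∈ s, f i) ≤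
      (∏ i ∈ s, ((f i).support.card : ℝ)) * maxNorm Q * ∏ i ∈ s, maxNorm (f i) := by
  classical
  induction s using Finset.induction_on with
  | empty => simp
  | insert a s ha ih =>
    rw [Finset.prod_insert ha, Finset.prod_insert ha, Finset.prod_insert ha, mul_left_comm]
    calc maxNorm (f a * (Q * ∏ i ∈ s, f i))
        ≤ (f a).support.card * maxNorm (f a) * maxNorm (Q * ∏ i ∈ s, f i) := maxNorm_mul_le _ _
      _ ≤ (f a).support.card * maxNorm (f a) *
            ((∏ i ∈ s, ((f i).support.card : ℝ)) * maxNorm Q * ∏ i ∈ s, maxNorm (f i)) :=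
          mul_le_mul_of_nonneg_left ih (mul_nonneg (Nat.cast_nonneg _) (maxNorm_nonneg _))
      _ = _ := by ring

/-- `4^d ≤ e^{4d}`. [folklore] -/
theorem four_pow_le_exp (d : ℕ) : (4 : ℝ) ^ d ≤ Real.exp (4 * d) := by
  rw [mul_comm, Real.exp_nat_mul]
  exact pow_le_pow_left₀ (by norm_num) (by linarith [Real.add_one_le_exp 4]) d

end PrimePartSplit

/-! ## The stub -/

/-- **Registered stub `primePartSplit3`**: a non-zero form `F` of degree `d` in `ℚ[x₀, …, x₃]`
lying in a prime ideal `𝔮'` factors as `F = G₂ · ∏ᵢ pᵢ` with `G₂ ∉ 𝔮'` a non-zero form of degree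
`d₂` and `k ≥ 1` prime forms `pᵢ ∈ 𝔮'` of degrees `aᵢ ≥ 1`, `d = d₂ + ∑ aᵢ`; the heights of the
factors are at most `h(F) + 4d` (Gauss + Gelfond: `sum_mul_height_map_le` with
`exists_eq_C_mul_map_primitive`, `height_C_mul`), and `|F| ≤ e^{4d} |G₂| ∏ |pᵢ|`
(`maxNorm_mul_le`, `#supp pᵢ ≤ 4^{aᵢ}`, `4^d ≤ e^{4d}`). [folklore] -/
theorem primePartSplit3 : ∀ (F : Rx 3) (d : ℕ) (𝔮' : Ideal (Rx 3)), F ≠ 0 → F.IsHomogeneous d → 𝔮'.IsPrime → F ∈ 𝔮' → ∃ (G₂ : Rx 3) (d₂ k : ℕ) (p : Fin k → Rx 3) (a : Fin k → ℕ), G₂ ≠ 0 ∧ G₂ ∉ 𝔮' ∧ G₂.IsHomogeneous d₂ ∧ (∀ i, p i ≠ 0 ∧ p i ∈ 𝔮' ∧ (p i).IsHomogeneous (a i) ∧ 1 ≤ a i ∧ (Ideal.span {p i}).IsPrime) ∧ 1 ≤ k ∧ F = G₂ * ∏ i, p i ∧ d = d₂ + ∑ i, a i ∧ height G₂ ≤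 height F + 4 * d ∧ (∀ i, height (p i) ≤ height F + 4 * d) ∧ maxNorm F ≤ Real.exp (4 * d) * maxNorm G₂ * ∏ i, maxNorm (p i) := by
  intro F d 𝔮' hF0 hF h𝔮' hF𝔮
  obtain ⟨G₂, d₂, k, p, a, hG0, hG𝔮, hGh, hp, hk, hFeq, hd⟩ :=
    PrimePartSplit.exists_split h𝔮' d F hF0 hF hF𝔮
  -- all the factors at once: `P 0 = G₂`, `P i.succ = p i`, of degrees `D 0 = d₂`, `D i.succ = a i`
  set P : Fin (k + 1) → Rx 3 := Fin.cons G₂ p with hPdef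
  set D : Fin (k + 1) → ℕ := Fin.cons d₂ a with hDdef
  have hP0 : ∀ i, P i ≠ 0 := fun i =>
    Fin.cases (by simpa [hPdef] using hG0) (fun j => by simpa [hPdef] using (hp j).1) i
  have hPD : ∀ i, (P i).IsHomogeneous (D i) := fun i =>
    Fin.cases (by simpa [hPdef, hDdef] using hGh)
      (fun j => by simpa [hPdef, hDdef] using (hp j).2.2.1) i
  have hprodP : ∏ i, P i = F := by
    rw [Fin.prod_univ_succ, hFeq]
    simp [hPdef]
  have hsumD : ∑ i, D i = d := by
    rw [Fin.sum_univ_succ, hd]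
    simp [hDdef]
  -- `∑_v ∑_i deg_v P_i ≤ 4 d`
  have hdeg : (∑ v : Fin (3 + 1), ∑ i, degreeOf v (P i)) ≤ 4 * d := by
    calc ∑ v : Fin (3 + 1), ∑ i, degreeOf v (P i) ≤ ∑ _v : Fin (3 + 1), d := by
          refine Finset.sum_le_sum fun v _ => ?_
          rw [← hsumD]
          refine Finset.sum_le_sum fun i _ => ?_
          rw [← (hPD i).totalDegree (hP0 i)]
          exact degreeOf_le_totalDegree (P i) v
      _ = 4 * d := by simp
  have hheight : ∀ j, height (P j) ≤ height F + 4 * d := by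
    intro j
    have h := PrimePartSplit.height_le_height_prod_add P hP0 j
    rw [hprodP] at h
    have h4 : ((∑ v : Fin (3 + 1), ∑ i, degreeOf v (P i) : ℕ) : ℝ) ≤ 4 * d := by
      exact_mod_cast hdeg
    linarith
  refine ⟨G₂, d₂, k, p, a, hG0, hG𝔮, hGh, hp, hk, hFeq, hd, by simpa [hPdef] using hheight 0,
    fun i => by simpa [hPdef] using hheight i.succ, ?_⟩
  -- max-norms: `|G₂ ∏ pᵢ| ≤ (∏ #supp pᵢ) |G₂| ∏ |pᵢ|` and `∏ #supp pᵢ ≤ 4^{∑ aᵢ} ≤ 4^d ≤ e^{4d}`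
  have hcard : ∏ i, ((p i).support.card : ℝ) ≤ Real.exp (4 * d) := by
    calc ∏ i, ((p i).support.card : ℝ) ≤ ∏ i, (4 : ℝ) ^ a i := by
          refine Finset.prod_le_prod (fun i _ => Nat.cast_nonneg _) fun i _ => ?_
          have h : (p i).support.card ≤ 4 ^ a i := card_support_le_pow_of_isHomogeneous (hp i).2.2.1
          exact_mod_cast h
      _ = 4 ^ ∑ i, a i := Finset.prod_pow_eq_pow_sum _ _ _
      _ ≤ 4 ^ d := pow_le_pow_right₀ (by norm_num) (by omega)
      _ ≤ Real.exp (4 * d) := PrimePartSplit.four_pow_le_exp d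
  rw [hFeq]
  exact (PrimePartSplit.maxNorm_mul_prod_le Finset.univ G₂ p).trans
    (mul_le_mul_of_nonneg_right (mul_le_mul_of_nonneg_right hcard (maxNorm_nonneg _))
      (Finset.prod_nonneg fun i _ => maxNorm_nonneg _))

end Summit.Schanuel.Schanuel.Cruxes.ApproximationProperty.OrbitInterpolationDeterminant

end
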